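import Literature.NumberTheory.Automorphic.Liu2021.AppendixC.Thm415PinnedOfFrobenius
import Literature.NumberTheory.GaloisRepresentations.CharacterFromFrobeniusPair
import HarnessLib

/-!
# A class of `ℚ_ℓ^{ac} ⊗ H¹_ét(A_∞)` on which almost all ARITHMETIC FROBENII act through a continuous scalar function
# is acted on through that function by EVERY `σ ∈ Γ_E` («Frobenius-dense ⇒ all σ», label-free exceptional sets)

Topic `NumberTheory/Automorphic/Liu2021/AppendixC`; namespace `Literature.NumberTheory.Automorphic.Liu2021.AppendixC`.
THEOREMS ONLY (no definition, no named fact, no instance, no `sorry`).  Sibling of `Thm415PinnedOfFrobenius.lean` («[Thm 4.15]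
pinned ⇐ its Frobenius form»), whose eigenvector device (`x ≠ 0` on the `M_μ`-line of `H¹_ét(A_μ)`, common scalar `∃ a`) is
replaced here by an EXTERNAL continuous scalar function `c : Γ_E → ℚ_ℓ^{ac}` — in the applications the rank-one `ℓ`-adic
character `σ ↦ r(σ)₀₀` of Weil's `ℓ`-adic avatar `r` of an algebraic Hecke character (`HeckeCharacter.IsAlgebraic.exists_lAdic`).

## Statements

Let `C : Sec42Data P5 isotropicAt` be a §4.2 datum over the CM extension `E/F` ([Liu2021] §4.2–4.3: the Albanese tower
`A_K = Alb X_K`, `H¹_ét(A_∞) = colim_K H¹_ét(A_K)`, its Galois representation `towerRep`), `ℓ` a prime,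
`y ∈ ℚ_ℓ^{ac} ⊗_{ℚ_ℓ} H¹_ét(A_∞)` ANY class, `Φ_σ := (towerRep σ).baseChange ℚ_ℓ^{ac}`.

* `Sec42Data.isClosed_setOf_towerRep_baseChange_eq_smul`: for a continuous `c : Γ_E → ℚ_ℓ^{ac}` the locus
  `{σ | Φ_σ y = c σ • y}` is CLOSED in the Krull topology (the class comes from one level `H¹_ét(A_K)`, where `Γ_E` acts through
  the CONTINUOUS rational Tate representation, `continuous_rationalTateRep_holds`; subspaces are closed for the
  `ℚ_ℓ^{ac}`-module topology, `isClosed_setOf_galoisH1Bar_eq_smul`).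
* `Sec42Data.towerRep_baseChange_eq_smul_of_frobenius`: if `Φ_σ y = c σ • y` for every arithmetic Frobenius `σ` at every prime
  above every place `v ∉ S`, `S` FINITE, then `Φ_σ y = c σ • y` for ALL `σ ∈ Γ_E` (Frobenius density
  `absoluteGaloisGroup.frobenius_dense` from Chebotarev `Automorphic.chebotarev_artinRep_holds`, zero hypotheses).
* `Sec42Data.towerRep_baseChange_eq_smul_of_hasFrobCharpolyAt`: for a rank-one `r : FramedGaloisRep E ℚ_ℓ^{ac} 1` with
  arithmetic-Frobenius characteristic polynomials `X - C (a v)` at all `v ∉ S` (`S` finite) and a class `y` on which the Frobenii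
  at the places `w ∉ T`, `w ∉ S` (`T` finite, ARBITRARY) act by `a w`: the Frobenii at EVERY `v ∉ S` act on `y` by `a v` — the
  exceptional set shrinks from `S ∪ T` to `S`.
* `Sec42Data.towerRep_baseChange_eq_inv_smul_of_eventually` (the consumer shape): for an ALGEBRAIC Hecke character `ψ` of `E`
  and `ι : ℂ ≃+* ℚ_ℓ^{ac}`, if `Φ_σ y = (ι (ψ(ϖ_w)))⁻¹ • y` for the arithmetic Frobenii `σ` over all but finitely many `w ∤ ℓ`
  (the `∀ᶠ w in cofinite` output of `Sec42Data.exists_heckeCharacter_towerRep_eq_inv_smul_of_ringHom`, [Liu2021 §D.4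
  l. 5626–5628]), then `Φ_σ y = (ι (ψ(ϖ_v)))⁻¹ • y` for the arithmetic Frobenii over EVERY `v ∤ ℓ` at which `ψ` is unramified —
  the LABEL-FREE exceptional set `{v ∣ ℓ} ∪ cond(ψ)` of the registered normalisation (arithmetic Frobenius, INVERSE uniformiser
  value), via Weil's `ℓ`-adic character of `ψ` ([Weil1956]; the tree's `HeckeCharacter.IsAlgebraic.exists_lAdic`).

Mathematics: [SerreAbelianLadic1968] Ch. I §2.2 Cor. 2 (a) (Frobenii are dense), §2.3 (a continuous representation is
determined by Frobenii); [SerreTate1968] §1 (continuity of `ρ_ℓ`); [Weil1956] (the `ℓ`-adic character of a Hecke character of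
type (A₀)).  In [Liu2021] this is the silent step «`ρ_ℓ(π^∞) = μ|·|^{-1/2}` as characters of `Gal(ℂ/E)`» of Thm. D.6 (1) /
Thm. 4.15 (l. 5436–5443, 2177–2182) read at ALL places prime to `ℓ` and the conductor, not only at almost all.

## References
* [Liu2021] Y. Liu, *Fourier–Jacobi cycles and arithmetic relative trace formula*, Camb. J. Math. 9 (2021), §4.2 (l. 2158–2160), Thm. 4.15 (l. 2177–2182),
  App. D Thm. D.6 (1) (l. 5433–5443), §D.4 (l. 5626–5628).
* [SerreAbelianLadic1968] J.-P. Serre, *Abelian ℓ-adic representations and elliptic curves* (1968), Ch. I §2.2 Cor. 2 (a), §2.3.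
* [SerreTate1968] J.-P. Serre, J. Tate, *Good reduction of abelian varieties*, Ann. of Math. 88 (1968), §1.
* [Weil1956] A. Weil, *On a certain type of characters of the idèle-class group of an algebraic number-field* (1956), §1–2.
-/

set_option autoImplicit false

noncomputable section

open NumberField IsDedekindDomain
open scoped TensorProduct NumberField

namespace Literature.NumberTheory.Automorphic.Liu2021.AppendixC

open Literature.AlgebraicGeometry.Motives (AbelianVariety)
open Literature.NumberTheory.GaloisRepresentations

/-! ## §1. Subspaces are closed for the module topology; continuity of the level-`K` Galois action on `ℚ_ℓ^{ac} ⊗ H¹_ét(B)` -/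
section Level

/-- For the MODULE topology on a vector space `W` over a topological field `L` with closed points, every subspace `N ≤ W` is
closed: `N` is the intersection of the kernels of the linear forms vanishing on it (Mathlib
`Subspace.dualAnnihilator_dualCoannihilator_eq`), and every linear form is continuous for the module topology
(`IsModuleTopology.continuous_of_linearMap`). [folklore] -/
private theorem isClosed_coe_submodule_of_isModuleTopology {L W : Type*} [Field L] [TopologicalSpace L]
    [IsTopologicalRing L] [T1Space L] [AddCommGroup W] [Module L W] [TopologicalSpace W] [IsModuleTopology L W]
    (N : Submodule L W) : IsClosed (N : Set W) := by
  have h : (N : Set W) = ⋂ φ ∈ N.dualAnnihilator, ((φ : W → L) ⁻¹' {0}) := by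
    ext x
    simp only [Set.mem_iInter, Set.mem_preimage, Set.mem_singleton_iff, SetLike.mem_coe]
    constructor
    · intro hx φ hφ
      exact (Submodule.mem_dualAnnihilator φ).mp hφ x hx
    · intro hx
      have hx' : x ∈ N.dualAnnihilator.dualCoannihilator :=
        (Submodule.mem_dualCoannihilator x).mpr fun φ hφ => hx φ hφ
      rwa [Subspace.dualAnnihilator_dualCoannihilator_eq] at hx'
  rw [h]
  exact isClosed_biInter fun φ _ => isClosed_singleton.preimage (IsModuleTopology.continuous_of_linearMap φ)

variable {E : Type} [Field E] [NumberField E] (ℓ : ℕ) [Fact ℓ.Prime]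

/-- `ℓ ≠ 0` in a number field. [folklore] -/
private theorem natCast_prime_ne_zero_numberField : (ℓ : E) ≠ 0 :=
  Nat.cast_ne_zero.mpr (Fact.out : ℓ.Prime).ne_zero

/-- **Continuity of the contragredient Galois action `σ ↦ σ·z` on `ℚ_ℓ^{ac} ⊗ H¹_ét(B ⊗_E Ē, ℚ_ℓ)` for the `ℚ_ℓ^{ac}`-MODULE
topology** (`B` an abelian variety over the number field `E`, `z` fixed): by `galoisH1Bar_eq_reconstruct`, `σ·z` is a finite
`ℚ_ℓ`-linear combination of fixed vectors with coefficients the matrix coefficients of `ρ_B(σ⁻¹)`, which are continuous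
(`continuous_dual_coeff`, from `continuous_rationalTateRep_holds`). [cite: SerreTate1968, §1] -/
theorem continuous_galoisH1Bar_apply (B : AbelianVariety E)
    (z : AlgebraicClosure ℚ_[ℓ] ⊗[ℚ_[ℓ]] Module.Dual ℚ_[ℓ] (B.rationalTateModule ℓ)) :
    letI : TopologicalSpace (AlgebraicClosure ℚ_[ℓ] ⊗[ℚ_[ℓ]] Module.Dual ℚ_[ℓ] (B.rationalTateModule ℓ)) :=
      moduleTopology (AlgebraicClosure ℚ_[ℓ]) (AlgebraicClosure ℚ_[ℓ] ⊗[ℚ_[ℓ]] Module.Dual ℚ_[ℓ] (B.rationalTateModule ℓ))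
    Continuous fun σ : Field.absoluteGaloisGroup E => galoisH1Bar ℓ B σ z := by
  classical
  letI : TopologicalSpace (AlgebraicClosure ℚ_[ℓ] ⊗[ℚ_[ℓ]] Module.Dual ℚ_[ℓ] (B.rationalTateModule ℓ)) :=
    moduleTopology (AlgebraicClosure ℚ_[ℓ]) (AlgebraicClosure ℚ_[ℓ] ⊗[ℚ_[ℓ]] Module.Dual ℚ_[ℓ] (B.rationalTateModule ℓ))
  haveI : IsModuleTopology (AlgebraicClosure ℚ_[ℓ])
      (AlgebraicClosure ℚ_[ℓ] ⊗[ℚ_[ℓ]] Module.Dual ℚ_[ℓ] (B.rationalTateModule ℓ)) := ⟨rfl⟩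
  haveI : ContinuousAdd (AlgebraicClosure ℚ_[ℓ] ⊗[ℚ_[ℓ]] Module.Dual ℚ_[ℓ] (B.rationalTateModule ℓ)) :=
    IsModuleTopology.toContinuousAdd (AlgebraicClosure ℚ_[ℓ]) _
  haveI : ContinuousSMul ℚ_[ℓ] (AlgebraicClosure ℚ_[ℓ] ⊗[ℚ_[ℓ]] Module.Dual ℚ_[ℓ] (B.rationalTateModule ℓ)) :=
    IsScalarTower.continuousSMul (AlgebraicClosure ℚ_[ℓ])
  have hℓ : (ℓ : E) ≠ 0 := natCast_prime_ne_zero_numberField (E := E) ℓ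
  haveI := Literature.AlgebraicGeometry.Motives.AbelianVariety.module_finite_rationalTateModule_of_cast_ne_zero B ℓ hℓ
  let b := Module.finBasis ℚ_[ℓ] (B.rationalTateModule ℓ)
  have hfun : (fun σ : Field.absoluteGaloisGroup E => galoisH1Bar ℓ B σ z) = fun σ =>
      ∑ k : Fin (Module.finrank ℚ_[ℓ] (B.rationalTateModule ℓ)) × Fin (Module.finrank ℚ_[ℓ] (B.rationalTateModule ℓ)),
        (b.coord k.1 (B.rationalTateRep ℓ σ⁻¹ (b k.2))) •
          ((Algebra.TensorProduct.basis (AlgebraicClosure ℚ_[ℓ]) b.dualBasis).repr z k.1 •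
            Algebra.TensorProduct.basis (AlgebraicClosure ℚ_[ℓ]) b.dualBasis k.2) :=
    funext fun σ => galoisH1Bar_eq_reconstruct ℓ B b z σ
  rw [hfun]
  exact continuous_finsetSum _ fun k _ => (continuous_dual_coeff ℓ B (b.coord k.1) (b k.2)).smul continuous_const

/-- **CLOSEDNESS OF THE `c`-EIGEN LOCUS at one level.**  For an abelian variety `B` over the number field `E`, a vector
`y' ∈ ℚ_ℓ^{ac} ⊗ H¹_ét(B)`, ANY `ℚ_ℓ^{ac}`-linear map `T` out of that space (in the application: the canonical map of one level into
`ℚ_ℓ^{ac} ⊗ H¹_ét(A_∞)`) and a CONTINUOUS function `c : Γ_E → ℚ_ℓ^{ac}`, the set of `σ ∈ Γ_E` with `T (σ·y') = c σ • T y'` is CLOSED in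
the Krull topology: it is the preimage of the subspace `ker T` (closed for the `ℚ_ℓ^{ac}`-module topology) under the continuous map
`σ ↦ σ·y' − c σ • y'` (`continuous_galoisH1Bar_apply`). [cite: SerreTate1968, §1] [cite: SerreAbelianLadic1968, Ch. I §2.3] -/
theorem isClosed_setOf_galoisH1Bar_eq_smul (B : AbelianVariety E) {W : Type*} [AddCommGroup W]
    [Module (AlgebraicClosure ℚ_[ℓ]) W]
    (T : (AlgebraicClosure ℚ_[ℓ] ⊗[ℚ_[ℓ]] Module.Dual ℚ_[ℓ] (B.rationalTateModule ℓ)) →ₗ[AlgebraicClosure ℚ_[ℓ]] W)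
    {c : Field.absoluteGaloisGroup E → AlgebraicClosure ℚ_[ℓ]} (hc : Continuous c)
    (y' : AlgebraicClosure ℚ_[ℓ] ⊗[ℚ_[ℓ]] Module.Dual ℚ_[ℓ] (B.rationalTateModule ℓ)) :
    IsClosed {σ : Field.absoluteGaloisGroup E | T (galoisH1Bar ℓ B σ y') = c σ • T y'} := by
  classical
  letI : TopologicalSpace (AlgebraicClosure ℚ_[ℓ] ⊗[ℚ_[ℓ]] Module.Dual ℚ_[ℓ] (B.rationalTateModule ℓ)) :=
    moduleTopology (AlgebraicClosure ℚ_[ℓ]) (AlgebraicClosure ℚ_[ℓ] ⊗[ℚ_[ℓ]] Module.Dual ℚ_[ℓ] (B.rationalTateModule ℓ))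
  haveI : IsModuleTopology (AlgebraicClosure ℚ_[ℓ])
      (AlgebraicClosure ℚ_[ℓ] ⊗[ℚ_[ℓ]] Module.Dual ℚ_[ℓ] (B.rationalTateModule ℓ)) := ⟨rfl⟩
  haveI : IsTopologicalAddGroup (AlgebraicClosure ℚ_[ℓ] ⊗[ℚ_[ℓ]] Module.Dual ℚ_[ℓ] (B.rationalTateModule ℓ)) :=
    IsModuleTopology.topologicalAddGroup (AlgebraicClosure ℚ_[ℓ]) _
  -- the continuous map `σ ↦ σ·y' − c σ • y'`
  have hG : Continuous fun σ : Field.absoluteGaloisGroup E => galoisH1Bar ℓ B σ y' - c σ • y' :=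
    (continuous_galoisH1Bar_apply ℓ B y').sub (hc.smul continuous_const)
  have hset : {σ : Field.absoluteGaloisGroup E | T (galoisH1Bar ℓ B σ y') = c σ • T y'} =
      (fun σ : Field.absoluteGaloisGroup E => galoisH1Bar ℓ B σ y' - c σ • y') ⁻¹'
        ((LinearMap.ker T : Submodule (AlgebraicClosure ℚ_[ℓ]) _) : Set _) := by
    ext σ
    simp only [Set.mem_setOf_eq, Set.mem_preimage, SetLike.mem_coe, LinearMap.mem_ker, map_sub, map_smul, sub_eq_zero]
  rw [hset]
  exact (isClosed_coe_submodule_of_isModuleTopology (LinearMap.ker T)).preimage hG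

/-- Only finitely many finite places of a number field lie above the prime `ℓ`. [folklore] -/
private theorem finite_setOf_natCast_prime_mem_asIdeal :
    {v : HeightOneSpectrum (𝓞 E) | (ℓ : 𝓞 E) ∈ v.asIdeal}.Finite := by
  have hI : (Ideal.span {(ℓ : 𝓞 E)} : Ideal (𝓞 E)) ≠ ⊥ := by
    rw [Ne, Ideal.span_singleton_eq_bot]
    exact_mod_cast (Fact.out : ℓ.Prime).ne_zero
  exact (Ideal.finite_factors hI).subset fun v hv => Ideal.dvd_span_singleton.2 hv

/-- The `(0,0)` matrix coefficient of a rank-one framed representation is continuous. [folklore] -/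
private theorem continuous_framedRep_apply_zero_zero {G : Type*} [Group G] [TopologicalSpace G] {A : Type*} [CommRing A]
    [TopologicalSpace A] (r : FramedRep G A 1) :
    Continuous fun g : G => ((r g : GL (Fin 1) A) : Matrix (Fin 1) (Fin 1) A) 0 0 :=
  (Units.continuous_val.comp (map_continuous r)).matrix_elem 0 0

end Level

/-! ## §2. The tower: closedness of the `c`-eigen locus and «Frobenius-dense ⇒ all σ» -/
section Tower

open scoped Classical

variable {F E : Type} [Field F] [NumberField F] [IsTotallyReal F] [Field E] [NumberField E] [Algebra F E]
  [IsTotallyComplex E] [Algebra.IsQuadraticExtension F E]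
variable {P5 : PropC5Data F E} {isotropicAt : ℕ → Prop}

namespace Sec42Data

/-- **Closedness in the tower.**  For a §4.2 datum `C`, a class `y ∈ ℚ_ℓ^{ac} ⊗ H¹_ét(A_∞ ⊗_E Ē, ℚ_ℓ)` and a continuous
`c : Γ_E → ℚ_ℓ^{ac}`, the locus `{σ | (1 ⊗ towerRep σ) y = c σ • y}` is CLOSED: `y` comes from one level `H¹_ét(A_K)`
(`exists_level_baseChange_of_eq`), where the Galois action is the level's (`towerRep_baseChange_of_baseChange`), and the
level statement is `isClosed_setOf_galoisH1Bar_eq_smul`. [cite: SerreTate1968, §1] [cite: Liu2021, §4.2 (FJcycle.tex l. 2158–2160)] -/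
theorem isClosed_setOf_towerRep_baseChange_eq_smul (C : Sec42Data P5 isotropicAt) (ℓ : ℕ) [Fact ℓ.Prime]
    {c : Field.absoluteGaloisGroup E → AlgebraicClosure ℚ_[ℓ]} (hc : Continuous c)
    (y : AlgebraicClosure ℚ_[ℓ] ⊗[ℚ_[ℓ]] C.etaleH1Tower ℓ) :
    IsClosed {σ : Field.absoluteGaloisGroup E |
      (C.towerRep ℓ σ).baseChange (AlgebraicClosure ℚ_[ℓ]) y = c σ • y} := by
  have hlev := exists_level_baseChange_of_eq C ℓ y
  obtain ⟨i, y', hy'⟩ := hlev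
  have key : ∀ τ : Field.absoluteGaloisGroup E, (C.towerRep ℓ τ).baseChange (AlgebraicClosure ℚ_[ℓ]) y =
      (Module.DirectLimit.of ℚ_[ℓ] (RestOne.Idx C) (C.etSysObj ℓ) (C.etSys ℓ) i).baseChange (AlgebraicClosure ℚ_[ℓ])
        (galoisH1Bar ℓ (C.A (OrderDual.ofDual i)) τ y') := by
    intro τ
    rw [← hy']
    exact towerRep_baseChange_of_baseChange C ℓ i τ y'
  have hset : {σ : Field.absoluteGaloisGroup E | (C.towerRep ℓ σ).baseChange (AlgebraicClosure ℚ_[ℓ]) y = c σ • y} =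
      {σ : Field.absoluteGaloisGroup E |
        (Module.DirectLimit.of ℚ_[ℓ] (RestOne.Idx C) (C.etSysObj ℓ) (C.etSys ℓ) i).baseChange (AlgebraicClosure ℚ_[ℓ])
            (galoisH1Bar ℓ (C.A (OrderDual.ofDual i)) σ y') =
          c σ • (Module.DirectLimit.of ℚ_[ℓ] (RestOne.Idx C) (C.etSysObj ℓ) (C.etSys ℓ) i).baseChange
            (AlgebraicClosure ℚ_[ℓ]) y'} := by
    ext σ
    simp only [Set.mem_setOf_eq]
    rw [key, hy']
  rw [hset]
  exact isClosed_setOf_galoisH1Bar_eq_smul ℓ (C.A (OrderDual.ofDual i)) _ hc y'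

/-- **«FROBENIUS-DENSE ⇒ ALL σ» for a class of `ℚ_ℓ^{ac} ⊗ H¹_ét(A_∞)`.**  Let `c : Γ_E → ℚ_ℓ^{ac}` be continuous and `S` a FINITE set
of finite places of `E`.  If every arithmetic Frobenius `σ` at every prime of `\bar ℤ_E` above every `v ∉ S` satisfies
`(1 ⊗ towerRep σ) y = c σ • y`, then EVERY `σ ∈ Γ_E` does: the locus is closed (`isClosed_setOf_towerRep_baseChange_eq_smul`) and
contains the dense set of those Frobenii (`absoluteGaloisGroup.frobenius_dense`, from Chebotarev's density theorem in the proved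
existence form `Automorphic.chebotarev_artinRep_holds`).
[cite: SerreAbelianLadic1968, Ch. I §2.2 Cor. 2 (a), §2.3] [cite: SerreTate1968, §1] -/
theorem towerRep_baseChange_eq_smul_of_frobenius (C : Sec42Data P5 isotropicAt) (ℓ : ℕ) [Fact ℓ.Prime]
    {c : Field.absoluteGaloisGroup E → AlgebraicClosure ℚ_[ℓ]} (hc : Continuous c)
    (y : AlgebraicClosure ℚ_[ℓ] ⊗[ℚ_[ℓ]] C.etaleH1Tower ℓ)
    {S : Set (HeightOneSpectrum (𝓞 E))} (hS : S.Finite)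
    (h : ∀ v ∉ S, ∀ 𝔓 ∈ v.primesAbove, ∀ σ : Field.absoluteGaloisGroup E, IsArithFrobAt (𝓞 E) σ 𝔓 →
      (C.towerRep ℓ σ).baseChange (AlgebraicClosure ℚ_[ℓ]) y = c σ • y)
    (σ : Field.absoluteGaloisGroup E) :
    (C.towerRep ℓ σ).baseChange (AlgebraicClosure ℚ_[ℓ]) y = c σ • y := by
  have hZc := C.isClosed_setOf_towerRep_baseChange_eq_smul ℓ hc y
  have hD := absoluteGaloisGroup.frobenius_dense Automorphic.chebotarev_artinRep_holds E S hS
  have hsub : {τ : Field.absoluteGaloisGroup E | ∃ v ∉ S, ∃ 𝔓 ∈ v.primesAbove, IsArithFrobAt (𝓞 E) τ 𝔓} ⊆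
      {τ : Field.absoluteGaloisGroup E | (C.towerRep ℓ τ).baseChange (AlgebraicClosure ℚ_[ℓ]) y = c τ • y} := by
    rintro τ ⟨v, hv, 𝔓, h𝔓, hτ⟩
    exact h v hv 𝔓 h𝔓 τ hτ
  have huniv : {τ : Field.absoluteGaloisGroup E | (C.towerRep ℓ τ).baseChange (AlgebraicClosure ℚ_[ℓ]) y = c τ • y} =
      Set.univ := by
    have hcl := (hD.mono hsub).closure_eq
    rwa [hZc.closure_eq] at hcl
  have hσ : σ ∈ {τ : Field.absoluteGaloisGroup E | (C.towerRep ℓ τ).baseChange (AlgebraicClosure ℚ_[ℓ]) y = c τ • y} := by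
    rw [huniv]; exact Set.mem_univ σ
  exact hσ

/-- **Framed edition.**  For a rank-one framed Galois representation `r : Γ_E →ₜ* GL_1(ℚ_ℓ^{ac})` and a class `y` on which every
arithmetic Frobenius over every place `v ∉ S` (`S` finite) acts by `r(σ)₀₀`: every `σ ∈ Γ_E` acts on `y` by `r(σ)₀₀`
(`towerRep_baseChange_eq_smul_of_frobenius` with the continuous matrix coefficient `σ ↦ r(σ)₀₀`).
[cite: SerreAbelianLadic1968, Ch. I §2.2 Cor. 2 (a), §2.3] -/
theorem towerRep_baseChange_eq_smul_of_frobenius_framed (C : Sec42Data P5 isotropicAt) (ℓ : ℕ) [Fact ℓ.Prime]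
    (r : FramedGaloisRep E (AlgebraicClosure ℚ_[ℓ]) 1) (y : AlgebraicClosure ℚ_[ℓ] ⊗[ℚ_[ℓ]] C.etaleH1Tower ℓ)
    {S : Set (HeightOneSpectrum (𝓞 E))} (hS : S.Finite)
    (h : ∀ v ∉ S, ∀ 𝔓 ∈ v.primesAbove, ∀ σ : Field.absoluteGaloisGroup E, IsArithFrobAt (𝓞 E) σ 𝔓 →
      (C.towerRep ℓ σ).baseChange (AlgebraicClosure ℚ_[ℓ]) y =
        ((r σ : GL (Fin 1) (AlgebraicClosure ℚ_[ℓ])) : Matrix (Fin 1) (Fin 1) (AlgebraicClosure ℚ_[ℓ])) 0 0 • y)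
    (σ : Field.absoluteGaloisGroup E) :
    (C.towerRep ℓ σ).baseChange (AlgebraicClosure ℚ_[ℓ]) y =
      ((r σ : GL (Fin 1) (AlgebraicClosure ℚ_[ℓ])) : Matrix (Fin 1) (Fin 1) (AlgebraicClosure ℚ_[ℓ])) 0 0 • y :=
  C.towerRep_baseChange_eq_smul_of_frobenius ℓ (continuous_framedRep_apply_zero_zero r) y hS h σ

/-- **The exceptional set of a Frobenius eigen-relation shrinks to that of the character.**  Let `r : Γ_E →ₜ* GL_1(ℚ_ℓ^{ac})` have
arithmetic-Frobenius characteristic polynomial `X - C (a v)` at every `v ∉ S` (`S` finite; the shape Weil's `ℓ`-adic character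
`HeckeCharacter.IsAlgebraic.exists_lAdic` delivers), and let `y ∈ ℚ_ℓ^{ac} ⊗ H¹_ét(A_∞)` be a class on which the arithmetic Frobenii
over the places `w ∉ T`, `w ∉ S` act by `a w`, for some OTHER finite set `T` (a label-dependent exceptional set).  Then the
arithmetic Frobenii over EVERY `v ∉ S` act on `y` by `a v`: by the framed edition every `σ` acts by `r(σ)₀₀`, and at `v ∉ S` a
Frobenius has `r(σ)₀₀ = a v` (`FramedGaloisRep.apply_eq_of_hasFrobCharpolyAt`).
[cite: SerreAbelianLadic1968, Ch. I §2.2 Cor. 2 (a), §2.3] -/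
theorem towerRep_baseChange_eq_smul_of_hasFrobCharpolyAt (C : Sec42Data P5 isotropicAt) (ℓ : ℕ) [Fact ℓ.Prime]
    (r : FramedGaloisRep E (AlgebraicClosure ℚ_[ℓ]) 1) (a : HeightOneSpectrum (𝓞 E) → AlgebraicClosure ℚ_[ℓ])
    {S T : Set (HeightOneSpectrum (𝓞 E))} (hS : S.Finite) (hT : T.Finite)
    (hr : ∀ v ∉ S, r.HasFrobCharpolyAt v (Polynomial.X - Polynomial.C (a v)))
    (y : AlgebraicClosure ℚ_[ℓ] ⊗[ℚ_[ℓ]] C.etaleH1Tower ℓ)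
    (h : ∀ w ∉ T, w ∉ S → ∀ 𝔓 ∈ w.primesAbove, ∀ σ : Field.absoluteGaloisGroup E, IsArithFrobAt (𝓞 E) σ 𝔓 →
      (C.towerRep ℓ σ).baseChange (AlgebraicClosure ℚ_[ℓ]) y = a w • y)
    {v : HeightOneSpectrum (𝓞 E)} (hv : v ∉ S) {𝔓 : Ideal (absIntegers (𝓞 E) E)} (h𝔓 : 𝔓 ∈ v.primesAbove)
    {σ : Field.absoluteGaloisGroup E} (hσ : IsArithFrobAt (𝓞 E) σ 𝔓) :
    (C.towerRep ℓ σ).baseChange (AlgebraicClosure ℚ_[ℓ]) y = a v • y := by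
  -- every Frobenius over `w ∉ S ∪ T` acts by `r(σ)₀₀ = a w`
  have hfrob : ∀ w ∉ S ∪ T, ∀ 𝔓' ∈ w.primesAbove, ∀ τ : Field.absoluteGaloisGroup E, IsArithFrobAt (𝓞 E) τ 𝔓' →
      (C.towerRep ℓ τ).baseChange (AlgebraicClosure ℚ_[ℓ]) y =
        ((r τ : GL (Fin 1) (AlgebraicClosure ℚ_[ℓ])) : Matrix (Fin 1) (Fin 1) (AlgebraicClosure ℚ_[ℓ])) 0 0 • y := by
    intro w hw 𝔓' h𝔓' τ hτ
    simp only [Set.mem_union, not_or] at hw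
    rw [h w hw.2 hw.1 𝔓' h𝔓' τ hτ, FramedGaloisRep.apply_eq_of_hasFrobCharpolyAt (hr w hw.1) h𝔓' hτ]
  -- hence every `σ` acts by `r(σ)₀₀`; read it at a Frobenius over `v ∉ S`
  rw [C.towerRep_baseChange_eq_smul_of_frobenius_framed ℓ r y (hS.union hT) hfrob σ,
    FramedGaloisRep.apply_eq_of_hasFrobCharpolyAt (hr v hv) h𝔓 hσ]

/-- **HECKE EDITION — the label-free exceptional set (consumer shape of [Liu2021, Thm. D.6 (1)] in the tree's normalisation).**
For a §4.2 datum `C`, `ι : ℂ ≃+* ℚ_ℓ^{ac}`, an ALGEBRAIC Hecke character `ψ` of `E` and a class `y ∈ ℚ_ℓ^{ac} ⊗ H¹_ét(A_∞)`: IF for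
all but finitely many places `w`, `w ∤ ℓ`, every arithmetic Frobenius `σ` at every prime above `w` acts by
`(1 ⊗ towerRep σ) y = (ι (ψ(ϖ_w)))⁻¹ • y` (the `∀ᶠ w in cofinite` conclusion of
`Sec42Data.exists_heckeCharacter_towerRep_eq_inv_smul_of_ringHom`, [Liu2021 §D.4 l. 5626–5628]), THEN the same identity holds for
the arithmetic Frobenii over EVERY place `v ∤ ℓ` at which `ψ` is UNRAMIFIED — exceptional set `{v ∣ ℓ} ∪ cond(ψ)`, independent of
the class.  Proof: Weil's `ℓ`-adic character `r` of `ψ` (`HeckeCharacter.IsAlgebraic.exists_lAdic`: arithmetic Frobenius at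
`v ∤ ℓ·cond(ψ)` ↦ `ι(ψ(ϖ_v))⁻¹`) and `towerRep_baseChange_eq_smul_of_hasFrobCharpolyAt`.
[cite: Weil1956, §1–§2] [cite: SerreAbelianLadic1968, Ch. I §2.2 Cor. 2 (a), §2.3]
[cite: Liu2021, Thm. D.6 (1) (FJcycle.tex l. 5436–5443) with §D.4 (l. 5626–5628)] -/
theorem towerRep_baseChange_eq_inv_smul_of_eventually (C : Sec42Data P5 isotropicAt) (ℓ : ℕ) [Fact ℓ.Prime]
    (ι : ℂ ≃+* AlgebraicClosure ℚ_[ℓ]) {ψ : HeckeCharacter E} (hψ : ψ.IsAlgebraic)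
    (y : AlgebraicClosure ℚ_[ℓ] ⊗[ℚ_[ℓ]] C.etaleH1Tower ℓ)
    (h : ∀ᶠ w : HeightOneSpectrum (𝓞 E) in Filter.cofinite, (ℓ : 𝓞 E) ∉ w.asIdeal →
      ∀ 𝔓 ∈ w.primesAbove, ∀ σ : Field.absoluteGaloisGroup E, IsArithFrobAt (𝓞 E) σ 𝔓 →
        (C.towerRep ℓ σ).baseChange (AlgebraicClosure ℚ_[ℓ]) y = (ι (ψ.valueAtUniformizer w))⁻¹ • y)
    {v : HeightOneSpectrum (𝓞 E)} (hvℓ : (ℓ : 𝓞 E) ∉ v.asIdeal) (hv : ψ.IsUnramifiedAt v)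
    {𝔓 : Ideal (absIntegers (𝓞 E) E)} (h𝔓 : 𝔓 ∈ v.primesAbove)
    {σ : Field.absoluteGaloisGroup E} (hσ : IsArithFrobAt (𝓞 E) σ 𝔓) :
    (C.towerRep ℓ σ).baseChange (AlgebraicClosure ℚ_[ℓ]) y = (ι (ψ.valueAtUniformizer v))⁻¹ • y := by
  -- Weil's `ℓ`-adic character of `ψ`
  have hr0 := hψ.exists_lAdic ι.symm
  obtain ⟨r, hr⟩ := hr0
  -- the label-free exceptional set `{v ∣ ℓ} ∪ cond(ψ)` and the given finite exceptional set `T`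
  set S : Set (HeightOneSpectrum (𝓞 E)) := {v | (ℓ : 𝓞 E) ∈ v.asIdeal} ∪ ψ.ramifiedPlaces with hSdef
  have hS : S.Finite :=
    (finite_setOf_natCast_prime_mem_asIdeal (E := E) ℓ).union (HeckeCharacter.finite_ramifiedPlaces_holds ψ)
  have hT : {w : HeightOneSpectrum (𝓞 E) | ¬ ((ℓ : 𝓞 E) ∉ w.asIdeal →
      ∀ 𝔓 ∈ w.primesAbove, ∀ σ : Field.absoluteGaloisGroup E, IsArithFrobAt (𝓞 E) σ 𝔓 →
        (C.towerRep ℓ σ).baseChange (AlgebraicClosure ℚ_[ℓ]) y = (ι (ψ.valueAtUniformizer w))⁻¹ • y)}.Finite :=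
    Filter.eventually_cofinite.mp h
  have hr' : ∀ v ∉ S, r.HasFrobCharpolyAt v (Polynomial.X - Polynomial.C ((ι (ψ.valueAtUniformizer v))⁻¹)) := by
    intro w hw
    simp only [hSdef, Set.mem_union, Set.mem_setOf_eq, not_or, HeckeCharacter.ramifiedPlaces, not_not] at hw
    have h2 := (hr w hw.1 hw.2).2
    simpa only [RingEquiv.symm_symm, map_inv₀] using h2
  have hvS : v ∉ S := by
    simp only [hSdef, Set.mem_union, Set.mem_setOf_eq, not_or, HeckeCharacter.ramifiedPlaces, not_not]
    exact ⟨hvℓ, hv⟩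
  refine C.towerRep_baseChange_eq_smul_of_hasFrobCharpolyAt ℓ r (fun v => (ι (ψ.valueAtUniformizer v))⁻¹) hS hT hr' y
    (fun w hw hwS 𝔓' h𝔓' τ hτ => ?_) hvS h𝔓 hσ
  simp only [Set.mem_setOf_eq, not_not] at hw
  have hwℓ : (ℓ : 𝓞 E) ∉ w.asIdeal := by
    simp only [hSdef, Set.mem_union, Set.mem_setOf_eq, not_or] at hwS
    exact hwS.1
  exact hw hwℓ 𝔓' h𝔓' τ hτ

end Sec42Data

end Tower

end Literature.NumberTheory.Automorphic.Liu2021.AppendixC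

end
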